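import Summits.CriticalPhenomena.PercolationContinuityZ3.Theorems.PercNearOneGluingNoHeavyQuantDIBStarCornerOneLight
import Summits.CriticalPhenomena.PercolationContinuityZ3.Theorems.PercNearOneGluingNoHeavyQuantRootReductionExtraBlobs
import HarnessLib

/-!
# QUANT lane R8, Conjecture DIB\* — the FLOOR-SPLIT INDUCTION made kernel: `DIB\* at every floor < 1 ⟺ STEP LEMMA FS`
# (the induction on the number of blobs is done here; what is left is one ∀∃ statement about a single hard instance
# GIVEN the capped row for each of its one-blob-deleted sub-systems at every floor)

builds on p205010 (kernel theorem, internal audit signed; external expert review pending)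

Statement + support file (`--supports stmt-CriticalPhenomena-4575`), QUANT lane lead (gen 17); memo
`run/shared/lean/prim/quant/prim-quant-lead-g17/LEAD-NOTES-G17.md` N33 (4); companion of `…QuantRootDecFloorSplit` (rules φ / ∨ / ∧).
TWO `Prop` definitions (`CappedRows`, the `@[conjecture]` `StepLemmaFS`), theorems otherwise; no sorries, standard axioms.

ARCHITECTURE FS (N33 (4)).  Conjecture DIB\* (`Quant.IndepBlob.DIBStar`) is open exactly in its corner (`DIBStarCorner`, typer g17;
`1/2 < x < 1`, heavy total `≤ 2j`, a non-empty light blob) and, by census-1 g14 / typer g18 (`IndepBlob.dibStarCorner_of_oneLight`), only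
with AT LEAST TWO non-empty light blobs and (rule α) no heavy giant.  Rule φ (`RootDec.term_ge_of_floorSplit`): conditioning on ANY blob
`k` splits the tail into the two tails of the system WITHOUT `k` (sure part raised by `a k`, or not), which may be certified at two
DIFFERENT floors `z₁ > x > z₀` with `g k·z₁ + (1 − g k)·z₀ ≥ x`; in an induction on the total size the full CAPPED ROW (DIB\* with light
giants shrunk, `RootDec.term_ge_of_dibWith_capped`'s hypothesis) of every one-blob-deleted sub-system is available AT EVERY FLOOR `< 1`
and every layer / sure part.  This file performs that induction once and for all:

* `Quant.RootDec.CappedRows a g` — the capped row of the system `(a, g)` at every floor `z < 1`, sure part `s`, layer `j`: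
  `2j < 2s + Σ_k [a k·g k if z ≤ g k, else min(a k, j − s)·max(κ_z(g k), 0)] ⟹ z ≤ TERM[s, a, g, j]`, `κ_z(g) = (g − z²)/(1 − z)`.
* `Quant.IndepBlob.StepLemmaFS` (`@[conjecture]`) — THE STEP LEMMA: for every HARD instance (floor `1/2 < x < 1`, gates in `[0,1]`, light
  sizes `≤ j`, heavy total `≤ 2j`, no heavy giant, two distinct non-empty light blobs, discounted credit `> 2j`) SUCH THAT every
  sub-system `a[k ↦ 0]` (`0 < a k`) satisfies `CappedRows`, the row `x ≤ P(N ≥ j+1)` holds.  (Any proof may split on any blob with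
  rule φ, any number of times, and use β/α/α′/γ/∨/∧ on the pieces — the hypothesis is the honest inductive hypothesis, nothing less.)
* **`Quant.RootDec.cappedRows_of_stepLemmaFS`** — `StepLemmaFS ⟹ CappedRows a g` for EVERY finite system with gates in `[0,1]`
  (strong induction on `Σ a`; floors `≤ 1/2` by `term_ge_of_credit_of_le_half` (lead g15's discounted Cantelli), light giants shrunk as in
  `term_ge_of_dibWith_capped`, heavy total `≥ 2(j−s)+1` by `term_ge_of_extraBlobs`, heavy giant by `gate_le_term_of_giant`, no light by
  `term_ge_of_budget`, one light by `IndepBlob.dibStarCorner_of_oneLight`, and the hard case by the step lemma fed with the induction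
  hypothesis).
* **`Quant.IndepBlob.dibStar_of_stepLemmaFS`** — `StepLemmaFS ⟹ DIBStar x` for every `x < 1`; with the trivial converse
  `stepLemmaFS_of_dibStar`, **`stepLemmaFS_iff_dibStar : StepLemmaFS ↔ ∀ x < 1, DIBStar x`.**

So T-DIB (README V185) = `StepLemmaFS`, a statement about ONE instance with a black-box row for its sub-systems.  EVIDENCE that the step
is always available with the menu {β, α′, γ at the branch floor, ∨, ∧} and a SINGLE application of rule φ (lead g17, N33 (4)): exhaustive
hard instances with gates k/12, ≤ 5 blobs, sizes ≤ 3, j ≤ 4: 27 318 / 0 failures; k/16, ≤ 4 blobs, sizes ≤ 4, j ≤ 5: 18 206 / 0; random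
4 000 / 0; credit-tight 2 495 / 0; kit j128119 / j128120 (exact rationals) attached to stmt-4575.  NOT PROVED here: `StepLemmaFS`.

NOVELTY.  presearch (N33): 'anti-concentration of weighted Bernoulli sums by conditioning on one summand at two thresholds, induction on
summands' → none (corpus hybrid + vsearch; galaxy); rule φ generalises rule δ of ARCH-TREES-G49 §2.4.  [this work; this lane's census];
the gluing rows served [cite: KozmaNitzan2024, Conjecture 3 (p. 15)]; product weights [cite: Grimmett1999, §1.3 p. 10].
-/

namespace Summit.CriticalPhenomena.PercolationContinuityZ3.Theorems

namespace Quant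

open Finset

namespace RootDec

variable {κ : Type*} [Fintype κ] [DecidableEq κ]

/-- product-Bernoulli weight of the set `W` of open blobs (as in `…QuantRootReduction`) -/
local notation3 "wt[" g ", " W "]" => ∏ k, (if k ∈ (W : Finset κ) then (g : κ → ℝ) k else 1 - (g : κ → ℝ) k)

/-- the TERM tail `P(s + Σ_{k open} a k ≥ j+1)` (as in `…QuantRootReduction`) -/
local notation3 "TERM[" s ", " a ", " g ", " j "]" =>
  ∑ W : Finset κ, wt[g, W] * (if (j : ℕ) + 1 ≤ (s : ℕ) + ∑ k ∈ W, (a : κ → ℕ) k then (1 : ℝ) else 0)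

/-- **The capped row of ONE system at every floor below one.**  For all `z < 1`, sure parts `s` and layers `j`: if
`2j < 2s + Σ_k [a k·g k  if z ≤ g k, else min(a k, j − s)·max((g k − z²)/(1 − z), 0)]` then `z ≤ TERM[s, a, g, j]`.
(= the hypothesis shape of `RootDec.term_ge_of_dibWith_capped`; `∀ x < 1, DIBStar x` is `CappedRows` for every system.) [this work] -/
def CappedRows (a : κ → ℕ) (g : κ → ℝ) : Prop :=
  ∀ (z : ℝ) (s j : ℕ), z < 1 →
    (2 * j : ℝ) < 2 * s + ∑ k, (if z ≤ g k then (a k : ℝ) * g k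
      else ((min (a k) (j - s) : ℕ) : ℝ) * max ((g k - z ^ 2) / (1 - z)) 0) →
    z ≤ TERM[s, a, g, j]

end RootDec

namespace IndepBlob

/-- **CONJECTURE — THE STEP LEMMA OF THE FLOOR-SPLIT INDUCTION (lead g17, LEAD-NOTES-G17 N33 (4)).**  For every HARD instance of
Conjecture DIB\* — floor `1/2 < x < 1`, blobs `k : κ` with sizes `a k ∈ ℕ` and gates `g k ∈ [0,1]`, layer `j`, light blobs (`g k < x`)
of size `≤ j`, heavy sizes totalling `≤ 2j`, NO heavy giant (`x ≤ g k ⟹ a k ≤ j`), TWO distinct non-empty light blobs, discounted credit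
`Σ_k a k·(g k | (g k − x²)/(1 − x)) > 2j` — such that EVERY one-blob-deleted sub-system `a[k ↦ 0]` (`0 < a k`) has the capped row at every
floor (`RootDec.CappedRows`), the row holds: `x ≤ P(Σ_{k open} a k ≥ j+1)`.  Equivalent to `∀ x < 1, DIBStar x` (`stepLemmaFS_iff_dibStar`).
Evidence: with ONE application of rule φ (`RootDec.term_ge_of_floorSplit`) and the branch menu {β, α′, γ, ∨, ∧} some blob `k` works on every
hard instance enumerated (27 318 + 18 206 exhaustive, 4 000 random, 2 495 credit-tight: 0 failures; no FIXED choice of `k` works on all).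
builds on p205010 (kernel theorem, internal audit signed; external expert review pending). [this work] [status: open] -/
@[conjecture] def StepLemmaFS : Prop :=
  ∀ (κ : Type) [Fintype κ] [DecidableEq κ] (a : κ → ℕ) (g : κ → ℝ) (j : ℕ) (x : ℝ),
    1 / 2 < x → x < 1 →
    (∀ k, 0 ≤ g k ∧ g k ≤ 1) →
    (∀ k, g k < x → a k ≤ j) →
    (∑ k ∈ Finset.univ.filter (fun k => x ≤ g k), a k ≤ 2 * j) →
    (∀ k, x ≤ g k → a k ≤ j) →
    (∃ k₁ k₂, k₁ ≠ k₂ ∧ g k₁ < x ∧ 0 < a k₁ ∧ g k₂ < x ∧ 0 < a k₂) →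
    (2 * j : ℝ) < ∑ k, (a k : ℝ) * (if x ≤ g k then g k else (g k - x ^ 2) / (1 - x)) →
    (∀ k, 0 < a k → RootDec.CappedRows (Function.update a k 0) g) →
    x ≤ ∑ W : Finset κ, (∏ k, if k ∈ W then g k else 1 - g k) * (if j + 1 ≤ ∑ k ∈ W, a k then (1 : ℝ) else 0)

/-- The step lemma follows from DIB\* below one (its conclusion is an instance of `DIBStar x`). [this work] -/
theorem stepLemmaFS_of_dibStar (h : ∀ x : ℝ, x < 1 → DIBStar x) : StepLemmaFS :=
  fun κ _ _ a g j x _ hx1 hg hlight _ _ _ hcredit _ => h x hx1 κ a g j hg hlight hcredit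

end IndepBlob

namespace RootDec

variable {κ : Type*} [Fintype κ] [DecidableEq κ]

/-- product-Bernoulli weight of the set `W` of open blobs (as in `…QuantRootReduction`) -/
local notation3 "wt[" g ", " W "]" => ∏ k, (if k ∈ (W : Finset κ) then (g : κ → ℝ) k else 1 - (g : κ → ℝ) k)

/-- the TERM tail `P(s + Σ_{k open} a k ≥ j+1)` (as in `…QuantRootReduction`) -/
local notation3 "TERM[" s ", " a ", " g ", " j "]" =>
  ∑ W : Finset κ, wt[g, W] * (if (j : ℕ) + 1 ≤ (s : ℕ) + ∑ k ∈ W, (a : κ → ℕ) k then (1 : ℝ) else 0)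

/-- Emptying a non-empty blob lowers the total size. -/
theorem sum_update_zero_lt (a : κ → ℕ) (k : κ) (hk : 0 < a k) : ∑ i, Function.update a k 0 i < ∑ i, a i := by
  have h1 : ∑ i, Function.update a k 0 i = ∑ i ∈ Finset.univ.erase k, a i := by
    rw [← Finset.add_sum_erase Finset.univ (Function.update a k 0) (Finset.mem_univ k), Function.update_self, zero_add]
    exact Finset.sum_congr rfl fun i hi => by rw [Function.update_of_ne (Finset.ne_of_mem_erase hi)]
  rw [h1, ← Finset.add_sum_erase Finset.univ a (Finset.mem_univ k)]
  omega

/-- **THE FLOOR-SPLIT INDUCTION: `StepLemmaFS ⟹` the capped row of EVERY finite system at every floor `< 1`.**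
Strong induction on `Σ a`; see the module docstring for the case analysis. [this work] -/
theorem cappedRows_of_stepLemmaFS (H : IndepBlob.StepLemmaFS) {κ : Type} [Fintype κ] [DecidableEq κ] (a : κ → ℕ)
    (g : κ → ℝ) (hg : ∀ k, 0 ≤ g k ∧ g k ≤ 1) : CappedRows a g := by
  suffices main : ∀ (A : ℕ) {κ : Type} [Fintype κ] [DecidableEq κ] (a : κ → ℕ) (g : κ → ℝ),
      (∀ k, 0 ≤ g k ∧ g k ≤ 1) → ∑ k, a k ≤ A → CappedRows a g from main _ a g hg le_rfl
  intro A
  induction A using Nat.strong_induction_on with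
  | _ A ih =>
  intro κ _ _ a g hg hA z s j hz1 hbudget
  -- floors ≤ 1/2: lead g15's discounted Cantelli (capped form, typer g17)
  by_cases hhalf : z ≤ 1 / 2
  · exact term_ge_of_credit_of_le_half s a g j z hhalf hg hbudget
  have hzhalf : 1 / 2 < z := not_le.1 hhalf
  -- a sure part ≥ j+1 decides
  by_cases hsure : j + 1 ≤ s
  · rw [term_eq_one_of_sure s a g j hsure]; exact hz1.le
  have hsj : s ≤ j := by omega
  have h1z : (0 : ℝ) < 1 - z := by linarith
  -- shrink the light giants (as in `term_ge_of_dibWith_capped`)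
  set a' : κ → ℕ := fun k => if z ≤ g k then a k else
    (if 0 < (g k - z ^ 2) / (1 - z) then min (a k) (j - s) else 0) with ha'
  have hle : ∀ k, a' k ≤ a k := by
    intro k
    simp only [ha']
    split_ifs
    · exact le_refl _
    · exact Nat.min_le_left _ _
    · exact Nat.zero_le _
  have hA' : ∑ k, a' k ≤ A := (Finset.sum_le_sum fun k _ => hle k).trans hA
  have hheavy' : ∀ k, z ≤ g k → a' k = a k := fun k hk => by simp only [ha']; rw [if_pos hk]
  have hlight' : ∀ k, g k < z → a' k ≤ j - s := by
    intro k hk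
    simp only [ha']
    rw [if_neg (not_le.2 hk)]
    split_ifs
    · exact Nat.min_le_right _ _
    · exact Nat.zero_le _
  -- the (uncapped) discounted credit of the shrunk system
  have hterm : ∀ k, (if z ≤ g k then (a k : ℝ) * g k else ((min (a k) (j - s) : ℕ) : ℝ) * max ((g k - z ^ 2) / (1 - z)) 0) =
      (a' k : ℝ) * (if z ≤ g k then g k else (g k - z ^ 2) / (1 - z)) := by
    intro k
    by_cases hk : z ≤ g k
    · rw [if_pos hk, if_pos hk, hheavy' k hk]
    · rw [if_neg hk, if_neg hk]
      simp only [ha']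
      rw [if_neg hk]
      by_cases hpos : 0 < (g k - z ^ 2) / (1 - z)
      · rw [if_pos hpos, max_eq_left hpos.le]
      · rw [if_neg hpos, max_eq_right (not_lt.1 hpos), Nat.cast_zero, mul_zero, zero_mul]
  have hcredit' : (2 * ((j - s : ℕ) : ℝ)) < ∑ k, (a' k : ℝ) * (if z ≤ g k then g k else (g k - z ^ 2) / (1 - z)) := by
    rw [← Finset.sum_congr rfl fun k _ => hterm k, Nat.cast_sub hsj]
    linarith
  refine le_trans ?_ (term_mono_sizes s a' a g j hg hle)
  -- heavy sizes reaching the odd threshold: the size row with extras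
  by_cases hbig : 2 * (j - s) + 1 ≤ ∑ k ∈ Finset.univ.filter (fun k => z ≤ g k), a' k
  · exact term_ge_of_extraBlobs s a' g j z hzhalf.le hz1.le hg hbig
  have hcorner : ∑ k ∈ Finset.univ.filter (fun k => z ≤ g k), a' k ≤ 2 * (j - s) := by omega
  -- a heavy giant decides
  by_cases hgiant : ∃ k, z ≤ g k ∧ j + 1 ≤ s + a' k
  · obtain ⟨k, hzk, hk⟩ := hgiant
    exact hzk.trans (gate_le_term_of_giant s a' g j hg k hk)
  have hnogiant : ∀ k, z ≤ g k → a' k ≤ j - s := by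
    intro k hk
    by_contra hcon
    exact hgiant ⟨k, hk, by omega⟩
  -- no non-empty light blob: FAR for independent blobs with a sure shift
  by_cases hpres : ∃ k, g k < z ∧ 0 < a' k
  swap
  · have hzero : ∀ k, g k < z → a' k = 0 := fun k hk => Nat.eq_zero_of_not_pos fun hpos => hpres ⟨k, hk, hpos⟩
    have hbudget'' : (2 * j : ℝ) < 2 * s + ∑ k, (a' k : ℝ) * g k := by
      have hsum : ∑ k, (a' k : ℝ) * (if z ≤ g k then g k else (g k - z ^ 2) / (1 - z)) = ∑ k, (a' k : ℝ) * g k := by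
        refine Finset.sum_congr rfl fun k _ => ?_
        by_cases hk : z ≤ g k
        · rw [if_pos hk]
        · rw [if_neg hk, hzero k (not_le.1 hk), Nat.cast_zero, zero_mul, zero_mul]
      rw [← hsum]
      have : (2 * ((j - s : ℕ) : ℝ)) = 2 * j - 2 * s := by rw [Nat.cast_sub hsj]; ring
      linarith
    exact term_ge_of_budget s a' g j z hz1.le hg (fun k hk => not_lt.1 fun h' => hk (hzero k h')) hbudget''
  obtain ⟨ℓ, hℓ, hℓa⟩ := hpres
  rw [term_shift s a' g j hsj]
  by_cases huniq : ∀ k, g k < z → 0 < a' k → k = ℓ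
  · -- exactly one non-empty light blob: census-1 g14 / typer g18
    exact IndepBlob.dibStarCorner_of_oneLight hzhalf.le hz1 a' g (j - s) hg hlight' hcorner ℓ hℓ hℓa huniq hcredit'
  -- the hard case: the step lemma, fed with the induction hypothesis for every one-blob-deleted sub-system
  push Not at huniq
  obtain ⟨k₂, hk₂, hk₂a, hk₂ℓ⟩ := huniq
  refine H κ a' g (j - s) z hzhalf hz1 hg hlight' hcorner hnogiant ⟨k₂, ℓ, hk₂ℓ, hk₂, hk₂a, hℓ, hℓa⟩ hcredit' ?_
  intro k hk
  exact ih _ (lt_of_lt_of_le (sum_update_zero_lt a' k hk) hA') _ g hg le_rfl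

end RootDec

namespace IndepBlob

/-- **`StepLemmaFS ⟹ DIB\*` at every floor `x < 1`.** [this work] -/
theorem dibStar_of_stepLemmaFS (H : StepLemmaFS) (x : ℝ) (hx1 : x < 1) : DIBStar x := by
  intro ι _ _ a g j hg hlight hcredit
  have hC := RootDec.cappedRows_of_stepLemmaFS H a g hg
  have hbudget : (2 * j : ℝ) < 2 * ((0 : ℕ) : ℝ) + ∑ k, (if x ≤ g k then (a k : ℝ) * g k
      else ((min (a k) (j - 0) : ℕ) : ℝ) * max ((g k - x ^ 2) / (1 - x)) 0) := by
    rw [Nat.cast_zero, mul_zero, zero_add]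
    refine hcredit.trans_le (Finset.sum_le_sum fun k _ => ?_)
    by_cases hk : x ≤ g k
    · rw [if_pos hk, if_pos hk]
    · rw [if_neg hk, if_neg hk, Nat.sub_zero, min_eq_left (hlight k (not_le.1 hk))]
      exact mul_le_mul_of_nonneg_left (le_max_left _ _) (Nat.cast_nonneg _)
  have key := hC x 0 j hx1 hbudget
  exact key.trans (le_of_eq (Finset.sum_congr rfl fun W _ => by rw [zero_add]))

/-- **T-DIB ≡ the step lemma**: `StepLemmaFS ↔ ∀ x < 1, DIBStar x`. [this work] -/
theorem stepLemmaFS_iff_dibStar : StepLemmaFS ↔ ∀ x : ℝ, x < 1 → DIBStar x :=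
  ⟨fun H x hx => dibStar_of_stepLemmaFS H x hx, stepLemmaFS_of_dibStar⟩

end IndepBlob

end Quant

end Summit.CriticalPhenomena.PercolationContinuityZ3.Theorems
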